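import Summits.BirchSwinnertonDyer.Rank1Residual.Additive.GordManinConstantKimCertificate
import Summits.BirchSwinnertonDyer.Rank1Residual.Additive.SubGordThree
import Literature.NumberTheory.EllipticCurves.ManinConstantModularDegree
import Literature.NumberTheory.EllipticCurves.SzpiroLocalDataProofs
import HarnessLib

/-!
# X3/X4 at an additive prime: the MANIN binder of every Kim / Kato / Kolyvagin consumer of the cell
# at EVERY `p ≥ 5` (and at a tame `p = 3`) from ONE class integer — the modular degree
# (Česnavičius–Neururer–Saha 2024 Thm. 1.2: `val_p(c_φ) ≤ val_p(deg φ)`)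

HONEST FRAMING (cell `b2b-bsdres`, run/shared/lean/b2b/bsd-rank1-residual/, verbatim in every
file): the goal of the cell is to DELETE the COMBINATION-SHAPED residual classes of the
Birch–Swinnerton-Dyer formula for ALL analytic-rank `≤ 1` elliptic curves over `ℚ` — "full BSD
formula for every rank `≤ 1` curve in class `C`" assembled STRICTLY from published theorems — so
that the rank-`≤ 1` remainder becomes exactly the CONSTRUCTION-SHAPED classes, which are TYPED
(missing-input `Prop`s), NOT attempted. This is not "finishing BSD". Sub-cell `additive-p2`
(CLASS-OWNERS row "X3/X4 additive — pot. good ordinary / X3♯(G-ord)"), generation 16: research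
route; no claim beyond the stated classes; theorems only, no definition, no new named fact minted
here (ONE PUBLISHED named fact enters as a hypothesis: `hCNS` = A159, Česnavičius–Neururer–Saha,
JEMS 26 (2024) Thm. 1.2, landed by the X12 seat as
`Literature/NumberTheory/EllipticCurves/ManinConstantModularDegree.lean`); X3♯(G-ord)/X4♯(G-ord)
stay CONSTRUCTION-SHAPED; no label moves; nothing is booked.

WHAT THIS FILE DOES. Generation 14 (`GordManinConstant.lean`, `GordManinConstantKimCertificate.lean`)
discharged the Manin datum `p ∤ c(D)` of the cell's Kim-2026 / Kolyvagin consumers by Edixhoven 1991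
Thm. 3 — for the STRONG curve, at `p ≥ 11`, OUTSIDE the printed exception "(G)-ordinary of Kodaira
type II, III, IV" (`Addv.typeGOrd_and_le_four_of_dvd_maninConstant`), leaving the datum standing
(AUDIT-X34-GORD §4 R10) exactly on: (i) every additive pair at `p ∈ {5, 7}` (Edixhoven needs
`p > 7`; Kim needs `p ≥ 5`), (ii) X4♯(G-ord) ∩ {II, III, IV} at `p ≥ 11` (21 894 of 227 851 optimal
X4 pairs, Cremona `N < 5·10⁵`), (iii) non-strong members (reached only through Cassels). The
published theorem of Česnavičius–Neururer–Saha (JEMS 26 (2024) Thm. 1.2, verbatim in the fact's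
file: "for every prime `p`, we have `val_p(c_φ) ≤ val_p(deg(φ)) + {1 if p = 2 …; 1 if p = 3 with
val_3(N) ≥ 3 and there is no p' ∣ N with p' ≡ 2 mod 3; 0 otherwise}" for EVERY surjection
`φ : X₀(N)_ℚ ↠ E`, optimal or not) replaces that datum, at every `p ≥ 5` and for ANY member of the
class with its own conductor-level parametrisation, by ONE decidable class integer: **`p ∤ deg φ`**
(`not_dvd_maninConstant_of_not_dvd_modularDegree`, the fact's file). This file threads it through
the additive cells:
* §1 (the bridge at a TAME `3`): `not_pow_dvd_conductorNorm_of_condExp_lt` (`f_p < k ⟹ p^k ∤ N`,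
  `N = ∏ p^{f_p}`, the tree's `factorization_conductorNorm_primesEquiv_symm`); hence at `p = 3`
  with `f₃ ≤ 2` — good, multiplicative, or TAME additive reduction at `3` (Kodaira I₀*, Iₙ*, III,
  III*: the (G-ord), (M) and (e = 4) cells at `3`) — the printed exceptional clause `3³ ∣ N` is
  void and `3 ∤ deg ⟹ 3 ∤ c` (`not_three_dvd_maninConstant_of_condExp_le_two_of_not_dvd_modularDegree`;
  on the (G)-cell `TypeG.not_three_dvd_maninConstant_of_not_dvd_modularDegree`, `f₃ = 2` being
  gen 8's theorem `condExpTwo_three_of_typeG_of_addv`). And the FINAL FORM of the additive Manin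
  binder, `Addv.not_dvd_maninConstant_of_edixhoven_or_degree`: at an additive `p ≥ 5`, `p ∤ c(D)`
  for a conductor-level datum `D` whenever EITHER (`p ≥ 11`, `D` strong, pair outside
  (G-ord) ∩ {II,III,IV}) OR `p ∤ deg(D)`.
* §2 (class X4, `p ≥ 5`, ANY member, ANY conductor, datum `D` at the conductor level with
  `p ∤ deg(D)` — NO strong/optimal hypothesis, NO Kodaira/type restriction): Kim's rank-`0`
  inequality `ClassX4.padicValNat_shaOrder_le_rankZero_of_not_dvd_modularDegree`, the typed upper
  half `…missingUpperBoundAt_rankZero_of_not_dvd_modularDegree` (`p ∤ ∏ c_ℓ`),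
  `…missingPPartAt_iff_lower_rankZero_…`, `…bsdp_rankZero_of_not_dvd_modularDegree_of_shaAn_unit`;
  BOTH ranks `ClassX4.bsdp_of_not_dvd_modularDegree_of_lowerHalves` (additive-p1's
  `AdditivePotMult.bsdp_of_classX4_of_lowerHalves`: Kim in rank `0`, Kolyvagin + Gross–Zagier in
  rank `1`) and its every-member form `ClassX4.bsdp_of_isIsogenous_of_not_dvd_modularDegree_of_lowerHalves`
  (Cassels; the pivot member need NOT be strong). The Kato 2004 Thm. 14.5 (3) route, the tame
  `p = 3` consumers and the per-pair Kim certificates are in the sibling file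
  `GordManinConstantDegreeKato.lean`.
* §3 (reading on the (G)-ordinary cell): `ClassX4Gord.bsdp_of_not_dvd_modularDegree_of_lowerHalves`
  — X4♯(G-ord) of ANY defect and ANY Kodaira type (II, III, IV included), BOTH ranks, EVERY
  `p ≥ 5` (so `p ∈ {5, 7}` included), `ρ̄` onto, `p ∤ ∏ c_ℓ`, `p ∤ deg(D)`: `BSD(E,p)` from the
  LOWER halves of the same-`j` X4 pairs alone.
EFFECT (class level, all conductors; census `HOME/b2b-bsdres-additive-p2/census/gen16/`): the Manin
binder of the additive cells is now EITHER Edixhoven (strong curve, `p ≥ 11`, outside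
(G-ord) ∩ {II,III,IV}) OR one decidable integer per member (`p ∤ deg φ`, Cremona's `alldegphi`
column; the minimal parametrisation of a non-optimal member factors through the optimal quotient,
so its degree is a multiple of the optimal member's and "some member has `p ∤ deg`" iff the
optimal one does). The located gap (the LOWER half / `CycLeadingTermAt` on
defect 3, 4, 6 / Delbourgo's MC (G)) is untouched: labels UNCHANGED; nothing booked.

References: K. Česnavičius, M. Neururer, A. Saha, J. Eur. Math. Soc. 26 (2024) 573–637, Thm. 1.2
[CesnaviciusNeururerSaha2023]; B. Edixhoven, Progr. Math. 89 (1991) 25–39, Thm. 3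
[EdixhovenManin1991]; C.-H. Kim, Amer. J. Math. 148 (2026) Thm. 1.8 [Kim2022StructureSelmer];
K. Kato, Astérisque 295 (2004) Thm. 14.5 (3), (12.5.2) [Kato2004Asterisque]; J. W. S. Cassels,
J. reine angew. Math. 217 (1965) [Cassels1965ArithmeticVIII]; J. E. Cremona, *Algorithms for
Modular Elliptic Curves* §2.10 (`deg φ`); J. H. Silverman, *AEC* C.16 (`N = ∏ p^{f_p}`).
-/

noncomputable section

open scoped Classical NumberField

open WeierstrassCurve IsDedekindDomain IsDedekindDomain.HeightOneSpectrum NumberField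
  Rat.HeightOneSpectrum Literature.NumberTheory.EllipticCurves
  Literature.NumberTheory.EllipticCurves.ModularForms
  Literature.NumberTheory.EllipticCurves.Rank1Residual
  Literature.NumberTheory.EllipticCurves.Rank1Residual.Typed
  Literature.NumberTheory.DiophantineGeometry

namespace Summit.BirchSwinnertonDyer.Rank1Residual.Additive

variable (W : WeierstrassCurve ℚ) [W.IsElliptic] [W.IsGloballyMinimal] (p : ℕ) [hp : Fact p.Prime]

/-! ### §1 The bridge: `f_p < k ⟹ p^k ∤ N`; the tame `3`; the final form of the additive Manin binder -/

omit [W.IsGloballyMinimal] in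
/-- **`f_p(E) < k ⟹ p^k ∤ N(E)`**: the conductor is `N = ∏ p^{f_p}` (the tree's
`factorization_conductorNorm_primesEquiv_symm`, Silverman *AEC* C.16) and `N > 0`
(`conductorNorm_pos_holds`). [cite: SilvermanAEC2009, C.16] -/
theorem not_pow_dvd_conductorNorm_of_condExp_lt {k : ℕ} (hk : condExp W p < k) :
    ¬ p ^ k ∣ W.conductorNorm ℤ := by
  intro hdvd
  have hN : W.conductorNorm ℤ ≠ 0 := (conductorNorm_pos_holds W).ne'
  have hle := (hp.out.pow_dvd_iff_le_factorization hN).mp hdvd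
  have hfac : (W.conductorNorm ℤ).factorization p = condExp W p :=
    factorization_conductorNorm_primesEquiv_symm W ⟨p, hp.out⟩
  omega

/-- **At a prime `3` with `f₃(E) ≤ 2` (good, multiplicative or TAME additive reduction at `3`),
`3 ∤ deg(D) ⟹ 3 ∤ c(D)`** for every parametrisation datum `D` of the globally minimal `W` at the
conductor level: the printed exceptional clause of Česnavičius–Neururer–Saha Thm. 1.2 at `p = 3`
requires `val_3(N) ≥ 3`, which `f₃ ≤ 2` excludes (`not_pow_dvd_conductorNorm_of_condExp_lt`), so the
row "`0` otherwise" applies (`not_three_dvd_maninConstant_of_not_dvd_modularDegree`, the fact's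
file). Named fact `hCNS` (A159). [cite: CesnaviciusNeururerSaha2023, Thm. 1.2] -/
theorem not_three_dvd_maninConstant_of_condExp_le_two_of_not_dvd_modularDegree
    (hCNS : cesnaviciusNeururerSaha_padicVal_maninConstant_le_modularDegree)
    (W : WeierstrassCurve ℚ) [W.IsElliptic] [W.IsGloballyMinimal]
    [NeZero (W.conductorNorm ℤ)] (D : ModularParametrizationData W (W.conductorNorm ℤ))
    (hf : condExp W 3 ≤ 2) (hdeg : ¬ 3 ∣ D.modularDegree) : ¬ (3 : ℤ) ∣ D.maninConstant :=
  not_three_dvd_maninConstant_of_not_dvd_modularDegree hCNS W D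
    (Or.inl (not_pow_dvd_conductorNorm_of_condExp_lt W 3 (by omega))) hdeg

/-- **On the (G)-cell at `3` (`TypeG W 3`, `E` additive at `3`: Kodaira I₀*, `f₃ = 2` by gen 8's
`condExpTwo_three_of_typeG_of_addv`), `3 ∤ deg(D) ⟹ 3 ∤ c(D)`** for every conductor-level datum `D`
— in particular on X3♯(G-ord) and X4♯(G-ord) at `p = 3`. Named fact `hCNS` (A159).
[cite: CesnaviciusNeururerSaha2023, Thm. 1.2] -/
theorem TypeG.not_three_dvd_maninConstant_of_not_dvd_modularDegree
    (hCNS : cesnaviciusNeururerSaha_padicVal_maninConstant_le_modularDegree)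
    (W : WeierstrassCurve ℚ) [W.IsElliptic] [W.IsGloballyMinimal]
    [NeZero (W.conductorNorm ℤ)] (D : ModularParametrizationData W (W.conductorNorm ℤ))
    (hG : TypeG W 3) (hadd : Addv W 3) (hdeg : ¬ 3 ∣ D.modularDegree) :
    ¬ (3 : ℤ) ∣ D.maninConstant :=
  not_three_dvd_maninConstant_of_condExp_le_two_of_not_dvd_modularDegree hCNS W D
    (le_of_eq (condExpTwo_three_of_typeG_of_addv W hG hadd)) hdeg

omit [W.IsGloballyMinimal] in
/-- **At every ADDITIVE `p ≥ 5`, `f_p = 2` (gen 9's `condExpTwo_of_addv_of_five_le`, the wild cell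
is empty), so `p³ ∤ N`** — recorded for the census reading "`p² ∥ N` on the whole additive locus at
`p ≥ 5`". [cite: SilvermanATAEC1994, IV Table 4.1 (PDF p. 365)] -/
theorem Addv.not_pow_three_dvd_conductorNorm_of_five_le (hp5 : 5 ≤ p) (hadd : Addv W p) :
    ¬ p ^ 3 ∣ W.conductorNorm ℤ :=
  not_pow_dvd_conductorNorm_of_condExp_lt W p
    (by rw [show condExp W p = 2 from condExpTwo_of_addv_of_five_le W p hp5 hadd]; norm_num)

/-- **THE ADDITIVE MANIN BINDER, FINAL FORM.** For `W/ℚ` globally minimal, ADDITIVE at `p ≥ 5`, and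
a parametrisation datum `D` at the conductor level: `p ∤ c(D)` as soon as EITHER
(Edixhoven 1991 Thm. 3, gen 14) `p ≥ 11`, `D` is strong (`Λ_E ⊆ c·Λ_f`) and the pair lies outside
"(G)-ordinary of Kodaira type II/III/IV" (`¬ TypeGOrd W p ∨ 4 < ord_p Δ_min`), OR
(Česnavičius–Neururer–Saha 2024 Thm. 1.2, this generation) `p ∤ deg(D)` — the latter with NO
strong/optimal hypothesis and NO restriction on the pair (so on X4♯(G-ord) ∩ {II,III,IV} and at
`p ∈ {5, 7}` too). Named facts `hEdx` (A130), `hEdxK` (p239550), `hCNS` (A159).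
[cite: EdixhovenManin1991, Thm. 3] [cite: CesnaviciusNeururerSaha2023, Thm. 1.2] -/
theorem Addv.not_dvd_maninConstant_of_edixhoven_or_degree
    (hEdx : edixhoven_not_dvd_maninConstant_of_not_potentiallyGoodOrdinary)
    (hEdxK : edixhoven_not_dvd_maninConstant_of_kodairaSymbol_ne)
    (hCNS : cesnaviciusNeururerSaha_padicVal_maninConstant_le_modularDegree)
    [NeZero (W.conductorNorm ℤ)] (D : ModularParametrizationData W (W.conductorNorm ℤ))
    (hp5 : 5 ≤ p) (hadd : Addv W p)
    (h : (7 < p ∧ (∀ z ∈ D.L.lattice, ∃ w ∈ periodLattice D.f, z = D.c * w) ∧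
        (¬ TypeGOrd W p ∨ 4 < padicValInt p W.minimalDiscriminantInt)) ∨ ¬ p ∣ D.modularDegree) :
    ¬ (p : ℤ) ∣ D.maninConstant := by
  rcases h with ⟨hp7, hopt, hexc⟩ | hdeg
  · exact Addv.not_dvd_maninConstant_of_exception W p hEdx hEdxK D hopt hp7 hadd hexc
  · exact not_dvd_maninConstant_of_not_dvd_modularDegree hCNS W D hp.out hp5 hdeg

/-! ### §2 Consumers: class X4 at every `p ≥ 5`, ANY member, the Manin datum from `p ∤ deg` -/

/-- **X4 ∧ `r = 0`, `p ≥ 5`, `ρ̄` onto, ANY member with a conductor-level datum `D`, `p ∤ deg(D)`: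
Kim's inequality `ord_p #Ш(E) ≤ ord_p #Ш_an(E) + ord_p ∏ c_ℓ` with NO Manin datum and NO
strong/optimal hypothesis** (Kim 2026 Thm. 1.8 (6) `hKim` via `X4RankZero.padicValNat_shaOrder_le`;
GZK; modularity; Česnavičius–Neururer–Saha `hCNS`). ANY reduction shape inside X4 (so every
additive cell: (M), (G-ord) of every Kodaira type, (T′)).
[cite: Kim2022StructureSelmer, Thm. 1.9 (6) (PDF p. 8)] [cite: CesnaviciusNeururerSaha2023, Thm. 1.2] -/
theorem ClassX4.padicValNat_shaOrder_le_rankZero_of_not_dvd_modularDegree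
    (hKim : Kim2026.rankZero_padicValNat_sha_le_of_maninConstant)
    (hGZK : rank_eq_analyticRank_of_analyticRank_le_one) (hmod : hasEntireLFunction_rat)
    (hCNS : cesnaviciusNeururerSaha_padicVal_maninConstant_le_modularDegree)
    (hp5 : 5 ≤ p) (hr : W.analyticRank = 0) (hX : ClassX4 W p) (hsurj : Surj W p)
    [NeZero (W.conductorNorm ℤ)] (D : ModularParametrizationData W (W.conductorNorm ℤ))
    (hdeg : ¬ p ∣ D.modularDegree) :
    ∃ q : ℚ, shaAn W = (q : ℂ) ∧
      (padicValNat p W.shaOrder : ℤ) ≤ padicValRat p q + padicValNat p W.tamagawaProduct :=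
  X4RankZero.padicValNat_shaOrder_le W p hKim hGZK hmod hp5 hr hX hsurj D
    (not_dvd_maninConstant_of_not_dvd_modularDegree hCNS W D hp.out hp5 hdeg)

/-- **The typed UPPER half `MissingUpperBoundAt W p` on X4 ∧ `r = 0`, `p ≥ 5`, `ρ̄` onto,
`p ∤ ∏ c_ℓ`, ANY member, `p ∤ deg(D)` — no Manin datum, no optimality.**
[cite: Kim2022StructureSelmer, Thm. 1.9 (6) (PDF p. 8)] [cite: CesnaviciusNeururerSaha2023, Thm. 1.2] -/
theorem ClassX4.missingUpperBoundAt_rankZero_of_not_dvd_modularDegree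
    (hKim : Kim2026.rankZero_padicValNat_sha_le_of_maninConstant)
    (hGZK : rank_eq_analyticRank_of_analyticRank_le_one) (hmod : hasEntireLFunction_rat)
    (hCNS : cesnaviciusNeururerSaha_padicVal_maninConstant_le_modularDegree)
    (hp5 : 5 ≤ p) (hr : W.analyticRank = 0) (hX : ClassX4 W p) (hsurj : Surj W p)
    [NeZero (W.conductorNorm ℤ)] (D : ModularParametrizationData W (W.conductorNorm ℤ))
    (hdeg : ¬ p ∣ D.modularDegree) (htam : ¬ p ∣ W.tamagawaProduct) : MissingUpperBoundAt W p :=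
  X4RankZero.missingUpperBoundAt W p hKim hGZK hmod hp5 hr hX hsurj D
    (not_dvd_maninConstant_of_not_dvd_modularDegree hCNS W D hp.out hp5 hdeg) htam

/-- **What remains is the LOWER half** (`MissingPPartAt W p ↔ MissingLowerBoundAt W p`) on X4 ∧
`r = 0`, `p ≥ 5`, `ρ̄` onto, `p ∤ ∏ c_ℓ`, ANY member, `p ∤ deg(D)`.
[cite: Kim2022StructureSelmer, Conj. 1.10 (PDF p. 8)] [cite: CesnaviciusNeururerSaha2023, Thm. 1.2] -/
theorem ClassX4.missingPPartAt_iff_lower_rankZero_of_not_dvd_modularDegree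
    (hKim : Kim2026.rankZero_padicValNat_sha_le_of_maninConstant)
    (hGZK : rank_eq_analyticRank_of_analyticRank_le_one) (hmod : hasEntireLFunction_rat)
    (hCNS : cesnaviciusNeururerSaha_padicVal_maninConstant_le_modularDegree)
    (hp5 : 5 ≤ p) (hr : W.analyticRank = 0) (hX : ClassX4 W p) (hsurj : Surj W p)
    [NeZero (W.conductorNorm ℤ)] (D : ModularParametrizationData W (W.conductorNorm ℤ))
    (hdeg : ¬ p ∣ D.modularDegree) (htam : ¬ p ∣ W.tamagawaProduct) :
    MissingPPartAt W p ↔ MissingLowerBoundAt W p :=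
  X4RankZero.missingPPartAt_iff_lower W p hKim hGZK hmod hp5 hr hX hsurj D
    (not_dvd_maninConstant_of_not_dvd_modularDegree hCNS W D hp.out hp5 hdeg) htam

/-- **`BSD(E,p)` on X4 ∧ `r = 0` at `p ≥ 5` when `#Ш_an` and `∏ c_ℓ` are `p`-units, `ρ̄` onto, ANY
member, `p ∤ deg(D)`** — Kim's inequality forces `Ш(E)[p^∞] = 0`; no Manin datum, no optimality.
[cite: Kim2022StructureSelmer, Thm. 1.9 (6) (PDF p. 8)] [cite: Miller2011LMS, Def. 1.1]
[cite: CesnaviciusNeururerSaha2023, Thm. 1.2] -/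
theorem ClassX4.bsdp_rankZero_of_not_dvd_modularDegree_of_shaAn_unit
    (hKim : Kim2026.rankZero_padicValNat_sha_le_of_maninConstant)
    (hGZK : rank_eq_analyticRank_of_analyticRank_le_one) (hmod : hasEntireLFunction_rat)
    (hCNS : cesnaviciusNeururerSaha_padicVal_maninConstant_le_modularDegree)
    (hp5 : 5 ≤ p) (hr : W.analyticRank = 0) (hX : ClassX4 W p) (hsurj : Surj W p)
    [NeZero (W.conductorNorm ℤ)] (D : ModularParametrizationData W (W.conductorNorm ℤ))
    (hdeg : ¬ p ∣ D.modularDegree) (htam : ¬ p ∣ W.tamagawaProduct)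
    {q : ℚ} (hq : shaAn W = (q : ℂ)) (hv : padicValRat p q = 0) : BSDp W p :=
  X4RankZero.bsdp_of_shaAn_unit W p hKim hGZK hmod hp5 hr hX hsurj D
    (not_dvd_maninConstant_of_not_dvd_modularDegree hCNS W D hp.out hp5 hdeg) htam hq hv

/-- **X4, BOTH analytic ranks, EVERY `p ≥ 5`, `ρ̄` onto, `p ∤ ∏ c_ℓ`, ANY member with a
conductor-level datum `D` and `p ∤ deg(D)`: `BSD(E,p)` from the LOWER halves of the same-`j` X4
pairs alone** — additive-p1's `AdditivePotMult.bsdp_of_classX4_of_lowerHalves` (Kim 2026 in rank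
`0`; Kolyvagin + Gross–Zagier over a Heegner field, Friedberg–Hoffstein, in rank `1`) with its Manin
datum DISCHARGED by Česnavičius–Neururer–Saha 2024 Thm. 1.2 (NO strong/optimal hypothesis, NO
Kodaira/type restriction, `p ∈ {5, 7}` included). Published binders only (`hKim`, `hGZ`, `hKo`,
`hB`, `hGZK`, `hmod`, `hnf`, `hFH`, `hCNS`). [cite: CesnaviciusNeururerSaha2023, Thm. 1.2]
[cite: Kim2022StructureSelmer, Thm. 1.9 (6) (PDF p. 8)] [cite: McCallumLMS1991, §1 Theorem (Kolyvagin), p. 296] -/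
theorem ClassX4.bsdp_of_not_dvd_modularDegree_of_lowerHalves
    (hKim : Kim2026.rankZero_padicValNat_sha_le_of_maninConstant)
    (hGZ : ∀ (N : ℕ) [NeZero N] (W : WeierstrassCurve ℚ) (K : Type) [Field K] [NumberField K],
      gross_zagier N W K)
    (hKo : ∀ (N : ℕ) [NeZero N] (W : WeierstrassCurve ℚ) (K : Type) [Field K] [NumberField K],
      kolyvagin N W K)
    (hB : ∀ (N : ℕ) [NeZero N] (W : WeierstrassCurve ℚ) (K : Type) [Field K] [NumberField K],
      Kolyvagin1990_padicValNat_card_sha_le N W K)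
    (hGZK : rank_eq_analyticRank_of_analyticRank_le_one) (hmod : hasEntireLFunction_rat)
    (hnf : exists_isNewformOf) (hFH : friedbergHoffstein_exists_heegnerField_split_twist_ne_zero)
    (hCNS : cesnaviciusNeururerSaha_padicVal_maninConstant_le_modularDegree)
    [NeZero (W.conductorNorm ℤ)] (hX : ClassX4 W p) (hr : W.analyticRank ≤ 1) (hsurj : Surj W p)
    (hp5 : 5 ≤ p) (D : ModularParametrizationData W (W.conductorNorm ℤ))
    (hdeg : ¬ p ∣ D.modularDegree) (htam : ¬ p ∣ W.tamagawaProduct)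
    (hlow : ∀ (V : WeierstrassCurve ℚ) [V.IsElliptic] [V.IsGloballyMinimal], ClassX4 V p →
      V.j = W.j → V.analyticRank ≤ 1 → MissingLowerBoundAt V p) :
    BSDp W p :=
  AdditivePotMult.bsdp_of_classX4_of_lowerHalves hKim hGZ hKo hB hGZK hmod hnf hFH hX hr hsurj hp5 D
    (not_dvd_maninConstant_of_not_dvd_modularDegree hCNS W D hp.out hp5 hdeg) htam hlow

/-- **Every curve of the class, from ANY member carrying a datum with `p ∤ deg`**: for `W/ℚ`
globally minimal, `ℚ`-isogenous to a member `W₀` (X4 at `p ≥ 5`, `ρ̄_{W₀,p}` onto, `r_an ≤ 1`,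
`p ∤ ∏ c_ℓ(W₀)`, `D₀` a conductor-level datum of `W₀` with `p ∤ deg(D₀)` — `W₀` need NOT be the
strong curve), the LOWER halves of the same-`j` X4 pairs give `BSDp W p` — Cassels' isogeny
invariance of the BSD quotient (`hCassels`, through `Wuthrich2014.bsdp_of_isIsogenous`; `Ш(W₀)`
finite by GZK, `L^{(r)}(W₀,1) ≠ 0`). Since the modular degree of a non-optimal member is a
multiple of the optimal member's (the parametrisation factors through the optimal quotient), the
natural pivot is the optimal curve — but optimality is not a hypothesis here.
[cite: Cassels1965ArithmeticVIII] [cite: CesnaviciusNeururerSaha2023, Thm. 1.2]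
[cite: Kim2022StructureSelmer, Thm. 1.9 (6) (PDF p. 8)] -/
theorem ClassX4.bsdp_of_isIsogenous_of_not_dvd_modularDegree_of_lowerHalves
    (hKim : Kim2026.rankZero_padicValNat_sha_le_of_maninConstant)
    (hGZ : ∀ (N : ℕ) [NeZero N] (W : WeierstrassCurve ℚ) (K : Type) [Field K] [NumberField K],
      gross_zagier N W K)
    (hKo : ∀ (N : ℕ) [NeZero N] (W : WeierstrassCurve ℚ) (K : Type) [Field K] [NumberField K],
      kolyvagin N W K)
    (hB : ∀ (N : ℕ) [NeZero N] (W : WeierstrassCurve ℚ) (K : Type) [Field K] [NumberField K],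
      Kolyvagin1990_padicValNat_card_sha_le N W K)
    (hGZK : rank_eq_analyticRank_of_analyticRank_le_one) (hmod : hasEntireLFunction_rat)
    (hnf : exists_isNewformOf) (hFH : friedbergHoffstein_exists_heegnerField_split_twist_ne_zero)
    (hCNS : cesnaviciusNeururerSaha_padicVal_maninConstant_le_modularDegree)
    (hCassels : bsdRHS_eq_of_isIsogenous)
    {W W₀ : WeierstrassCurve ℚ} [W.IsElliptic] [W₀.IsElliptic] [W.IsGloballyMinimal]
    [W₀.IsGloballyMinimal] [NeZero (W₀.conductorNorm ℤ)] (hiso : IsIsogenous W W₀)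
    (hX : ClassX4 W₀ p) (hr : W₀.analyticRank ≤ 1) (hsurj : Surj W₀ p) (hp5 : 5 ≤ p)
    (D₀ : ModularParametrizationData W₀ (W₀.conductorNorm ℤ)) (hdeg : ¬ p ∣ D₀.modularDegree)
    (htam : ¬ p ∣ W₀.tamagawaProduct)
    (hlow : ∀ (V : WeierstrassCurve ℚ) [V.IsElliptic] [V.IsGloballyMinimal], ClassX4 V p →
      V.j = W₀.j → V.analyticRank ≤ 1 → MissingLowerBoundAt V p) :
    BSDp W p :=
  Wuthrich2014.bsdp_of_isIsogenous hCassels hiso (hGZK W₀ hr).2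
    (W₀.leadingLCoeff_ne_zero_holds (hmod W₀))
    (ClassX4.bsdp_of_not_dvd_modularDegree_of_lowerHalves W₀ p hKim hGZ hKo hB hGZK hmod hnf hFH
      hCNS hX hr hsurj hp5 D₀ hdeg htam hlow)

/-! ### §3 Readings on the (G)-ordinary cell: every defect, every Kodaira type, every `p ≥ 5` -/

/-- **X4♯(G-ord) of ANY defect and ANY Kodaira type (II, III, IV — Edixhoven's exception —
included), BOTH analytic ranks, EVERY `p ≥ 5` (so `p ∈ {5, 7}`), `ρ̄` onto, `p ∤ ∏ c_ℓ`, ANY member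
with a conductor-level datum `D` and `p ∤ deg(D)`: `BSD(E,p)` from the LOWER halves of the same-`j`
X4 pairs alone** — the (G)-cell reading of `ClassX4.bsdp_of_not_dvd_modularDegree_of_lowerHalves`.
With gen 14's `ClassX4Gord.bsdp_of_strong_of_four_lt_of_lowerHalves` (starred types, strong curve,
`p ≥ 11`, no degree condition) this exhausts the published discharges of the Manin datum on the
cell; the remaining input is the typed LOWER half (the located gap), labels UNCHANGED.
[cite: CesnaviciusNeururerSaha2023, Thm. 1.2] [cite: Kim2022StructureSelmer, Thm. 1.9 (6) (PDF p. 8)]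
[cite: McCallumLMS1991, §1 Theorem (Kolyvagin), p. 296] -/
theorem ClassX4Gord.bsdp_of_not_dvd_modularDegree_of_lowerHalves
    (hKim : Kim2026.rankZero_padicValNat_sha_le_of_maninConstant)
    (hGZ : ∀ (N : ℕ) [NeZero N] (W : WeierstrassCurve ℚ) (K : Type) [Field K] [NumberField K],
      gross_zagier N W K)
    (hKo : ∀ (N : ℕ) [NeZero N] (W : WeierstrassCurve ℚ) (K : Type) [Field K] [NumberField K],
      kolyvagin N W K)
    (hB : ∀ (N : ℕ) [NeZero N] (W : WeierstrassCurve ℚ) (K : Type) [Field K] [NumberField K],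
      Kolyvagin1990_padicValNat_card_sha_le N W K)
    (hGZK : rank_eq_analyticRank_of_analyticRank_le_one) (hmod : hasEntireLFunction_rat)
    (hnf : exists_isNewformOf) (hFH : friedbergHoffstein_exists_heegnerField_split_twist_ne_zero)
    (hCNS : cesnaviciusNeururerSaha_padicVal_maninConstant_le_modularDegree)
    [NeZero (W.conductorNorm ℤ)] (hX : ClassX4Gord W p) (hr : W.analyticRank ≤ 1)
    (hsurj : Surj W p) (hp5 : 5 ≤ p) (D : ModularParametrizationData W (W.conductorNorm ℤ))
    (hdeg : ¬ p ∣ D.modularDegree) (htam : ¬ p ∣ W.tamagawaProduct)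
    (hlow : ∀ (V : WeierstrassCurve ℚ) [V.IsElliptic] [V.IsGloballyMinimal], ClassX4 V p →
      V.j = W.j → V.analyticRank ≤ 1 → MissingLowerBoundAt V p) :
    BSDp W p :=
  ClassX4.bsdp_of_not_dvd_modularDegree_of_lowerHalves W p hKim hGZ hKo hB hGZK hmod hnf hFH hCNS hX.1
    hr hsurj hp5 D hdeg htam hlow

end Summit.BirchSwinnertonDyer.Rank1Residual.Additive

end
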